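import Mathlib
import Summits.CriticalPhenomena.CardyFormulaZ2.Theorems.CardyMagicRigidityDefs
import Literature.Probability.RandomPlanarGeometry.LocFinLoopConfig
import Literature.Barriers.CriticalPhenomena.NestingTransformBlindness
import HarnessLib

/-!
# Vocabulary of line `positive-cone-weight-doubling` for crux `NestingRigidity` (stmt-CriticalPhenomena-4835)

Route `CardyMagicRigidity` (sub-problem `CriticalPhenomena/CardyFormulaZ2`), crux
`Summit.CriticalPhenomena.CardyFormulaZ2.Theses.CardyMagicRigidity.NestingRigidity ≡
MagicFormulaZ2 → MagicFormulaT → LoopLimitZ2EqT`.  This file is the **definitions module** of the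
checked skeleton `Cruxes/NestingRigidity/Lines/positive-cone-weight-doubling.lean` (planner
`planner-cruxplan-stmt-CriticalPhenomena-4835-positive-cone-weight-0`; line lead
`prover-line-stmt-CriticalPhenomena-4835-2`, third lead seat on the crux), reshaped by the lead so that
the line shares the COUNTING VOCABULARY already landed for the sibling line `ring-cloud-tomography`
(`Theorems/CardyMagicRigidityDefs.lean`, p71837): the two lattice ensembles `zEns` / `tEns`, the tower
count `towerCount c x ρ R` (loops with trace in `B(x, R)` whose winding interior contains `B̄(x, ρ)`),
the multi-disc pattern count `patternCount c z r R S`, and the tilted one-point tower moment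
`LoopEnsemble.towerMoment` — instead of the near-duplicates `towerCount` / `nestCount` / `towerMomentZ2`
of the planner's file (same objects up to the order of conjuncts and `Disjoint` vs subset-of-complement;
reusing them makes `measurable_towerCount` / `measurable_patternCount` (p72444) and the peeling lemma
`tendsto_cylinder_of_tendsto_tilt` (p75974) available to the stubs of this line verbatim).

What is NEW here (nothing is asserted; every `def … : Prop` is a statement to be proved by a registered
stub, or a predicate):

* the lever's constants `magicWeight t = 2cos(t + π/3)`, `beta = 3/(4π²)`, `nuSix = 1/(2π√3)` and its
  two outputs in honest sandwich form — `ConeTiltLaw E` (self-consistent cone law: the tilted tower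
  moment renormalised by the UV drift `exp(√3 t · E[N(r→1)])` of the SAME ensemble has exactly the
  Gaussian exponent `βt²`) and `NestingDensity E` (`E_δ[N(r→1)] = (ν ± η) log(1/r)`), over the mean tower
  count `meanTower E δ r`;
* the identification vocabulary — tilted multi-disc moments `tilt E`, cylinder probabilities `cyl E`
  (the event is literally that of `NestingStatisticsAgree`), `TiltAgreementAt` / `LawAgreementAt`
  (one disc configuration), `PositiveTiltAgreement` / `NestingLawAgreement` (every `n`, every centre
  vector, Lebesgue-a.e. radius vector and window), the regularity predicate `Regular` of a limit
  configuration (the lattice structure the barrier `NestingTransformBlindness` says must be USED: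
  local finiteness, covering degree one, trace = frontier of the winding interior, laminar interiors,
  separating) and `PrecompactRegular E` (`d_CN`-precompactness with a.s.-regular limits presented on
  `([0,1], Leb)`);
* the six registered STUB STATEMENTS as named `Prop`s (`ConeScaling`, `WeightDoubling`,
  `RingTomography`, `PGFUniqueness`, `Precompactness`, `TreeRigidity`) and the pure-logic glue
  `nestingRigidity_of_statements` (the six statements imply the crux BY NAME; anchor of this module on
  the crux item), plus the lever's algebra (`magicWeight_doubling`, `exponent_gap`,
  `density_from_doubling`, `calibrated_exponent_eq_magicExponent_six`: the calibrated exponent is SSW's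
  `Δ₆` of the barrier file), all proved.

Objects and the meaning of each statement: see the docstrings (they are the skeleton's, with the
vocabulary substitutions above).
-/

noncomputable section

open MeasureTheory Set Filter Metric
open scoped Real Topology BigOperators ENNReal

namespace Summit.CriticalPhenomena.CardyFormulaZ2.Cruxes.NestingRigidity.PositiveConeWeightDoubling

open Literature.Probability.RandomPlanarGeometry Literature.Probability.Percolation
  Literature.Probability.LatticeModels
open Summit.CriticalPhenomena.CardyFormulaZ2.Theses.CardyMagicRigidity
open Summit.CriticalPhenomena.CardyFormulaZ2.Cruxes.NestingRigidity.RingCloudTomography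

/-! ### Definitional checks against the route and the sibling vocabulary -/

/-- The crux's conclusion `X = LoopLimitZ2EqT` is the `d_CN`-merger of the two lattice ensembles
`zEns`, `tEns` of `CardyMagicRigidityDefs` (definitional check). -/
example : LoopLimitZ2EqT ↔
    Tendsto (fun δ : ℝ ↦ LoopConfig.cnLawEDist zEns.P (zEns.X δ) tEns.P (tEns.X δ)) (𝓝[>] 0) (𝓝 0) :=
  Iff.rfl

/-- The crux is literally `MagicFormulaZ2 → MagicFormulaT → LoopLimitZ2EqT`. -/
example : NestingRigidity ↔ (MagicFormulaZ2 → MagicFormulaT → LoopLimitZ2EqT) := Iff.rfl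

/-! ### The lever's constants -/

/-- The BKW / DKLM loop weight seen by a loop of charge `t`: `w(t) = cos_{1/6}(t) = 2cos(t + π/3)`
(`= UnbasedLoop.nestingFactor f u` when `u.nestingPhase f = t`). `w(0) = 1`, `w(−π/3) = 2`, `w(π/6) = 0`. -/
def magicWeight (t : ℝ) : ℝ := 2 * Real.cos (t + π / 3)

/-- The Gaussian self-energy coefficient `β = 3/(4π²)` of `MagicFormulaZ2` (`exp(β ∬ log‖x−y‖ f f)`). -/
def beta : ℝ := 3 / (4 * π ^ 2)

/-- The predicted nesting density of loops per e-fold of scale, `ν = 1/(2π√3) ≈ 0.0919`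
(= `1/E[B₆]`, Schramm–Sheffield–Wilson; = 4 × the Cardy–Ziff hull density constant). -/
def nuSix : ℝ := 1 / (2 * π * Real.sqrt 3)

/-! ### One-point (n = 1) vocabulary over `towerCount` -/

/-- Mean one-point tower count `E_δ[N_0(r, 1)]` of an ensemble at mesh `δ`: the expected number of
loops (both types) with trace in the unit window `B(0,1)` whose winding interior contains `B̄(0, r)`
(`towerCount`, the count whose `u`-tilted moment is `LoopEnsemble.towerMoment`). -/
def meanTower (E : LoopEnsemble) (δ r : ℝ) : ℝ := ∫ ω, (towerCount (E.X δ ω) 0 r 1 : ℝ) ∂E.P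

/-- **Self-consistent cone law** for an ensemble (for `zEns`: the output of `stub_coneScaling`). For
every charge `t` in the positive cone `(−π/6, π/6)` and every `η > 0`, for all small radii `r` and then
all small meshes `δ`:
`r^{βt²+η} ≤ E_δ[w(t)^{N_0(r,1)}] · exp(√3 t · E_δ[N_0(r,1)]) ≤ r^{βt²−η}` — the tilted tower moment,
renormalised by the UV drift of the SAME ensemble, has exactly the Gaussian exponent `βt²`. Nothing
about a scaling limit, a nesting density or the existence of exponents is presupposed (at `t = 0` it is
trivial: `w(0) = 1`). -/
def ConeTiltLaw (E : LoopEnsemble) : Prop :=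
  ∀ t ∈ Set.Ioo (-(π / 6)) (π / 6), ∀ η : ℝ, 0 < η → ∃ r₀ : ℝ, 0 < r₀ ∧ ∀ r ∈ Set.Ioo (0 : ℝ) r₀,
    ∀ᶠ δ in 𝓝[>] (0 : ℝ),
      r ^ (beta * t ^ 2 + η) ≤
          E.towerMoment (magicWeight t) δ r * Real.exp (Real.sqrt 3 * t * meanTower E δ r) ∧
        E.towerMoment (magicWeight t) δ r * Real.exp (Real.sqrt 3 * t * meanTower E δ r) ≤
          r ^ (beta * t ^ 2 - η)

/-- **Nesting density** of an ensemble (for `zEns`: the output of `stub_weightDoubling`): for every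
`η > 0`, for all small `r` and then all small meshes, `(ν − η) log(1/r) ≤ E_δ[N_0(r,1)] ≤ (ν + η) log(1/r)`
with `ν = nuSix = 1/(2π√3)`: existence AND value of the mean number of loops surrounding `B̄(0,r)`
inside `B(0,1)`. -/
def NestingDensity (E : LoopEnsemble) : Prop :=
  ∀ η : ℝ, 0 < η → ∃ r₀ : ℝ, 0 < r₀ ∧ ∀ r ∈ Set.Ioo (0 : ℝ) r₀, ∀ᶠ δ in 𝓝[>] (0 : ℝ),
    (nuSix - η) * Real.log (1 / r) ≤ meanTower E δ r ∧ meanTower E δ r ≤ (nuSix + η) * Real.log (1 / r)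

/-! ### Multi-disc (n ≥ 2) vocabulary over `patternCount` -/

/-- The non-empty index sets `∅ ≠ S ⊆ [n]`. -/
def nonemptyParts (n : ℕ) : Finset (Finset (Fin n)) := Finset.univ.filter fun S ↦ S.Nonempty

/-- Tilted multi-disc nesting moment `E_δ[∏_{S ≠ ∅} u_S^{N_S}]` of an ensemble at mesh `δ`, for the
discs `B̄(x i, r i)` and the window `B(0, R)` (`N_S = patternCount · x r R S`: loops in the window
surrounding exactly the discs indexed by `S`). -/
def tilt (E : LoopEnsemble) {n : ℕ} (x : Fin n → ℂ) (r : Fin n → ℝ) (R : ℝ)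
    (u : Finset (Fin n) → ℝ) (δ : ℝ) : ℝ :=
  ∫ ω, ∏ S ∈ nonemptyParts n, u S ^ patternCount (E.X δ ω) x r R S ∂E.P

/-- Cylinder probability of the pattern-count vector `(N_S)_{S ≠ ∅}` of an ensemble at mesh `δ` (the
event is literally the one compared in `NestingStatisticsAgree`). -/
def cyl (E : LoopEnsemble) {n : ℕ} (x : Fin n → ℂ) (r : Fin n → ℝ) (R : ℝ)
    (k : Finset (Fin n) → ℕ) (δ : ℝ) : ℝ :=
  (E.P {ω | ∀ S : Finset (Fin n), S.Nonempty → patternCount (E.X δ ω) x r R S = k S}).toReal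

/-- **Tilted-moment agreement at one disc configuration**: there is a non-empty OPEN set `U` of
positive weight vectors `(u_S)_S` on which the tilted pattern moments of bond-`ℤ²` and site-`𝕋` are
eventually bounded and asymptotically equal as `δ → 0⁺`. -/
def TiltAgreementAt (n : ℕ) (x : Fin n → ℂ) (r : Fin n → ℝ) (R : ℝ) : Prop :=
  ∃ U : Set (Finset (Fin n) → ℝ), IsOpen U ∧ U.Nonempty ∧ (∀ u ∈ U, ∀ S, 0 < u S) ∧
    ∀ u ∈ U, (∃ M : ℝ, ∀ᶠ δ in 𝓝[>] (0 : ℝ), tilt zEns x r R u δ ≤ M ∧ tilt tEns x r R u δ ≤ M) ∧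
      Tendsto (fun δ : ℝ ↦ tilt zEns x r R u δ - tilt tEns x r R u δ) (𝓝[>] 0) (𝓝 0)

/-- **Law agreement at one disc configuration**: every cylinder probability of the pattern-count vector
`(N_S)_{S ≠ ∅}` has asymptotically the same value on bond-`ℤ²` and on site-`𝕋`. -/
def LawAgreementAt (n : ℕ) (x : Fin n → ℂ) (r : Fin n → ℝ) (R : ℝ) : Prop :=
  ∀ k : Finset (Fin n) → ℕ,
    Tendsto (fun δ : ℝ ↦ cyl zEns x r R k δ - cyl tEns x r R k δ) (𝓝[>] 0) (𝓝 0)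

/-- **Positive tilt agreement** (output of `stub_ringTomography`): for every number of discs and every
centre vector, for Lebesgue-a.e. positive radius vector and window radius (tangency radii are a null
set of discontinuities of the counts), `TiltAgreementAt` holds. -/
def PositiveTiltAgreement : Prop :=
  ∀ (n : ℕ) (x : Fin n → ℂ), ∀ᵐ p : (Fin n → ℝ) × ℝ, (∀ i, 0 < p.1 i) → 0 < p.2 → TiltAgreementAt n x p.1 p.2

/-- **Nesting-law agreement** (output of `stub_pgfUniqueness` lifted through `∀ᵐ`): for every `n` and
centres, for a.e. radii and window, all cylinder probabilities of `(N_S)_{S ≠ ∅}` agree asymptotically.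
(The all-radii, disjoint-disc form is the sibling line's `NestingStatisticsAgree`.) -/
def NestingLawAgreement : Prop :=
  ∀ (n : ℕ) (x : Fin n → ℂ), ∀ᵐ p : (Fin n → ℝ) × ℝ, (∀ i, 0 < p.1 i) → 0 < p.2 → LawAgreementAt n x p.1 p.2

/-! ### Regular limit configurations and precompactness -/

/-- **Regularity of a (limit) loop configuration** — the lattice structure that the barrier
`NestingTransformBlindness` says must be USED: local finiteness; covering degree one (`W ∈ {0, ±1}`,
kills the double-circle witness); the trace is the frontier of the winding interior (kills point loops /
needles); LAMINARITY of winding interiors (non-crossing: nested or disjoint — fails for the conditional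
CLE₃⊔CLE₃ impostor); and distinct loops have distinct interiors up to reversal. -/
structure Regular (c : LoopConfig ℂ) : Prop where
  /-- finitely many loops of diameter `≥ ε` in every window -/
  locallyFinite : c.IsLocallyFinite
  /-- covering degree one -/
  degreeOne : ∀ u ∈ c.loops, ∀ z : ℂ, u.wind z = 0 ∨ u.wind z = 1 ∨ u.wind z = -1
  /-- the trace is the frontier of the winding interior (no null-interior loops, no two-sided arcs) -/
  boundary : ∀ u ∈ c.loops, u.range = frontier {z | u.wind z ≠ 0}
  /-- non-crossing: winding interiors are nested or disjoint -/
  laminar : ∀ u ∈ c.loops, ∀ v ∈ c.loops,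
    {z | u.wind z ≠ 0} ⊆ {z | v.wind z ≠ 0} ∨ {z | v.wind z ≠ 0} ⊆ {z | u.wind z ≠ 0} ∨
      Disjoint {z | u.wind z ≠ 0} {z | v.wind z ≠ 0}
  /-- distinct loops have distinct interiors (up to orientation) -/
  separating : ∀ u ∈ c.loops, ∀ v ∈ c.loops, {z | u.wind z ≠ 0} = {z | v.wind z ≠ 0} → u = v ∨ u = v.reverse

/-- **`d_CN`-precompactness with regular limits** of a mesh-indexed ensemble: every mesh sequence
`δₖ → 0⁺` has a subsequence along which the laws of `E.X δₖ` converge in DKKMO's coupling distance to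
SOME law, presented on `([0,1], Leb)`, carried by regular configurations. -/
def PrecompactRegular (E : LoopEnsemble) : Prop :=
  ∀ δs : ℕ → ℝ, Tendsto δs atTop (𝓝[>] (0 : ℝ)) →
    ∃ φ : ℕ → ℕ, StrictMono φ ∧ ∃ X : unitInterval → LoopConfig ℂ,
      (∀ᵐ s : unitInterval, Regular (X s)) ∧
        Tendsto (fun k : ℕ ↦ LoopConfig.cnLawEDist E.P (E.X (δs (φ k))) volume X) atTop (𝓝 0)

/-! ### The six stub statements -/

/-- Statement of STUB 1 (M–L) — **the positive cone**: `MagicFormulaZ2 → ConeTiltLaw zEns`. Proof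
route: apply the hypothesis to `f = t(ρ_{B(0,r)} − ρ_A)`, `A = {1 ≤ |z| < 2}` (bounded, measurable,
compactly supported, mean zero — an admissible `Cloud` density of the sibling vocabulary):
`Λ_δ(f) → C_t r^{βt²}` exactly (mean-value property of `log` for `ρ_A`, scaling of `ρ_r`; cf.
`CloudEnergy`, p74556). Loop side, `|t| < π/6`: ALL weights `2cos(θ_u + π/3)` are `≥ 0` (every partial
charge lies in `(−|t|, |t|)`), so the tilted measure is an honest positive measure on non-crossing loop
ensembles and FKG-free quasi-multiplicativity / separation of scales (RSW on `ℤ²`) are legal: loops of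
scale `≍ 1` and `≍ r` contribute O(1) factors uniformly in `δ` and `r`; the microscopic loops cutting the
disc / the annulus contribute `exp(−√3 t Σ_u b_u)(1 + O(Σ b_u²))` with
`E Σ_u b_u = E_δ[N_disc pt] − E_δ[N_annulus pt] = −E_δ[N_0(r,1)] + O(1)` (translation invariance of
`P_{1/2}`; `δ` cancels) and O(1) fluctuations (per-scale variance `≲ (s/r)²`, summable); the tower factor
is `w(t)^{N_0(r,1)}`.  Why it might fail: the drift need not be deterministic to exponential accuracy
(then only a quenched version holds).  Missing input (named by the two earlier lead seats): RSW
quasi-multiplicativity of positively WEIGHTED tower functionals on `ℤ²`. -/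
def ConeScaling : Prop := MagicFormulaZ2 → ConeTiltLaw zEns

/-- Statement of STUB 2 (M) — **weight doubling**: `MagicFormulaZ2 → ConeTiltLaw zEns →
NestingDensity zEns`. Proof route: fix one `t ∈ (−π/6, π/6)` and its partner `t' = −t − 2π/3 ∈
(−5π/6, −π/2)`: `w(t') = w(t) ≥ 0` (`magicWeight_doubling`). Run the single-radius identity of STUB 1 at
charge `t'`: tower weight and UV weights are still `≥ 0` and the drift is still
`exp(−√3 t' E_δ N)·O(1)`; the ONLY signed factors are the O(1) loops at scale 1 cutting a large fraction
of the annulus (triage F1), handled by a signed-scale-1-factor decoupling lemma with non-zero limiting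
mean. Dividing the identities at `t'` and `t` (same tower weight!) kills the tower moment:
`exp(√3 (t' − t) E_δ N) = r^{β(t'² − t²) + o(1)}`, i.e. `E_δ[N_0(r,1)] = (2πβ/(3√3) + o(1)) log(1/r) =
(ν + o(1)) log(1/r)` (`exponent_gap`, `density_from_doubling`). Why it might fail: the limiting mean of
the signed scale-1 factor vanishes for the chosen `t` (then move `t`), or the signed decoupling needs a
rate. -/
def WeightDoubling : Prop := MagicFormulaZ2 → ConeTiltLaw zEns → NestingDensity zEns

/-- Statement of STUB 3 (XL, LOAD-BEARING) — **ring-cloud tomography, calibrated**: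
`MagicFormulaZ2 → MagicFormulaT → ConeTiltLaw zEns → NestingDensity zEns → PositiveTiltAgreement`.
Neutralise charged multi-disc configurations by RING spectator charges (constant logarithmic potential
inside a ring ⇒ the Gaussian side factorises exactly band by band, `∏_k (L_k/L_{k+1})^{βΛ_k²}`), so that
the loop side sees an arbitrary piecewise positive weight profile on the nesting towers while all
weights and UV factors stay `≥ 0` for partial charges in `(−π/6, π/6)` (an OPEN set of weights off the
"ellipse arc"); the `n = 1` calibration (`ConeTiltLaw`, `NestingDensity`; the 𝕋-side twins by the
mirror argument or from Camia–Newman + SSW) cancels every UV drift and every ring self-energy and ring–ring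
energy in FUSION RATIOS, leaving identities LINEAR in the unknown entrance amplitudes at each layer;
both lattices satisfy the same identities, hence — "electric rank one / no dark tower modes", to be
DERIVED from non-crossing (the conditional CLE₃⊔CLE₃ impostor of the barrier satisfies every transform
identity and is excluded only there) — the same positively tilted moments on an open weight set, for
a.e. radii (tangency atoms are Lebesgue-null). This is where `MagicFormulaT` is used, and the only
place; it is the crux's open content (the sibling line's promoted S4a `stub_towerTilt` in calibrated,
multi-disc form). -/
def RingTomography : Prop :=
  MagicFormulaZ2 → MagicFormulaT → ConeTiltLaw zEns → NestingDensity zEns → PositiveTiltAgreement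

/-- Statement of STUB 4 (M) — **PGF uniqueness in limit form**, pointwise in the disc configuration:
if the tilted pattern moments `E[∏ u_S^{N_S}]` of the two lattices are eventually bounded and
asymptotically equal for all weight vectors `u` in a non-empty open subset `U` of the positive orthant,
then every cylinder probability of `(N_S)_{S≠∅}` is asymptotically equal. Proof route: the counts are
measurable (`measurable_patternCount`, p72444) and the laws are probability laws, so
`tilt E x r R u δ = Σ_k cyl E x r R k δ · u^k`; pass to subsequential limits of the two families of laws
of the `ℕ^{2ⁿ−1}`-valued count vectors (compactness in `[0,1]^ℕ`; sub-probability limits suffice), use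
the moment bound at a point `u¹ ∈ U` above `u` to dominate (`(u/u¹)^k`), so that the limit PGFs — power
series with non-negative coefficients — converge on the box below `u¹` and agree on the open set
`U ∩ box(u¹)`; identity theorem (one-variable along rays `s ↦ s·v`, Mathlib `HasFPowerSeriesAt.eq_zero`
after `AnalyticOnNhd.eqOn_zero_of_preconnected_of_eventuallyEq_zero`, then homogeneous components are
polynomials agreeing on an open set) ⇒ equal coefficients ⇒ the differences of cylinder probabilities
tend to `0` along every subsequence (`Filter.tendsto_of_subseq_tendsto`). Pure analysis / probability. -/
def PGFUniqueness : Prop :=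
  ∀ (n : ℕ) (x : Fin n → ℂ) (r : Fin n → ℝ) (R : ℝ), TiltAgreementAt n x r R → LawAgreementAt n x r R

/-- Statement of STUB 5 (L) — **precompactness with regular limits**, for bond-`ℤ²` AND site-`𝕋`:
every mesh sequence has a subsequence along which the typed full-plane loop ensembles converge in
`d_CN` (`LoopConfig.cnLawEDist`) to a law on `([0,1], Leb)` carried by `Regular` configurations. Proof
route: Aizenman–Burchard tightness from uniform RSW annulus-crossing bounds (tree:
`isTightLaws_map_bondInterface_holds` is the chordal-interface version on `ℤ²`; `exists_isFullPlaneCNLLaw`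
gives the 𝕋 convergence outright modulo the named Camia–Newman fact), Prokhorov on `CNLoopSpace`
(`levyProkhorovEDist_map_toCN_le_cnLawEDist`) and lifting back to `d_CN` by local finiteness; regularity
of limits: `degreeOne` and `laminar` pass to `udist`-limits of simple nested-or-disjoint lattice loops
(`UnbasedLoop.wind_eq_or_eq_neg_of_udist_lt`), `boundary`/`separating`/`locallyFinite` from polynomial
6-arm / whole-plane arm bounds (no two macroscopic loops at vanishing distance, no needles). Missing
inputs (named by the two earlier lead seats): ℤ²-side AB `d_CN`-precompactness of `bondLoopConfig δ 0`
(no name in the tree) and a.s. regularity of full-plane CLE₆ samples. -/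
def Precompactness : Prop := PrecompactRegular zEns ∧ PrecompactRegular tEns

/-- Statement of STUB 6 (L) — **nesting-tree rigidity ⇒ `d_CN`**, along a doubly convergent mesh
sequence: if bond-`ℤ²` converges to a regular law `X` and site-`𝕋` to a regular law `X'`, agreement of
all pattern-count cylinder probabilities (a.e. radii) forces `d_CN(bond_{δₖ}, site_{δₖ}) → 0`. Proof
route: (1) continuity — for a.e. radii the counts `N_S` are a.s. continuous at the limit under
`d_CN`-convergence (winding numbers are `udist`-stable off the trace; tangency to a fixed circle is a
null event for a.e. radius by Fubini), so `X` and `X'` have the same joint laws of `(N_S)` over a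
countable base of rational discs with good radii; (2) reconstruction — for a `Regular` configuration
each loop is recovered from the set of base discs it surrounds (`{W ≠ 0}` is the union of the base discs
inside it, the trace is its frontier: `Regular.boundary`, `degreeOne`; distinct loops give distinct
sets: `separating`; the multiset of incidence profiles is read off the counts by `laminar` + local
finiteness), measurably, hence the UNTYPED laws of `X`, `X'` coincide up to `cnEDist = 0`; (3) types —
along the nesting tree types alternate (child ≠ parent, exact on both lattices) and the one remaining
global bit is a fair coin independent of the untyped configuration (self-duality of bond-`ℤ²` at `1/2`
up to a `δ/2` shift, colour-flip symmetry of site-`𝕋`: `(U, B) =ᵈ (U, ¬B)`), so the TYPED laws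
coincide; (4) gluing — `cnLawEDist_triangle` twice (the sibling line's `TransferGluing`, p72412:
`tendsto_cnLawEDist_bond_site_of_common_limit`). -/
def TreeRigidity : Prop :=
  ∀ (δs : ℕ → ℝ) (X X' : unitInterval → LoopConfig ℂ), Tendsto δs atTop (𝓝[>] (0 : ℝ)) →
    Tendsto (fun k : ℕ ↦ LoopConfig.cnLawEDist zEns.P (zEns.X (δs k)) volume X) atTop (𝓝 0) →
    Tendsto (fun k : ℕ ↦ LoopConfig.cnLawEDist tEns.P (tEns.X (δs k)) volume X') atTop (𝓝 0) →
    (∀ᵐ s : unitInterval, Regular (X s)) → (∀ᵐ s : unitInterval, Regular (X' s)) →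
    NestingLawAgreement →
      Tendsto (fun k : ℕ ↦ LoopConfig.cnLawEDist zEns.P (zEns.X (δs k)) tEns.P (tEns.X (δs k)))
        atTop (𝓝 0)

/-! ### The lever's algebra, proved (weight doubling, exponent gap, the density, the calibration) -/

/-- `w(0) = 1`: at charge zero the tilt is trivial. -/
@[simp] theorem magicWeight_zero : magicWeight 0 = 1 := by
  simp [magicWeight, Real.cos_pi_div_three]

/-- **Weight doubling**: the involution `t ↦ −t − 2π/3` fixes the loop weight. -/
theorem magicWeight_doubling (t : ℝ) : magicWeight (-t - 2 * π / 3) = magicWeight t := by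
  unfold magicWeight
  rw [show -t - 2 * π / 3 + π / 3 = -(t + π / 3) by ring, Real.cos_neg]

/-- … but NOT the Gaussian exponent: `β(t'² − t²) = (t + π/3)/π` is linear in `t`. -/
theorem exponent_gap (t : ℝ) : beta * ((-t - 2 * π / 3) ^ 2 - t ^ 2) = (t + π / 3) / π := by
  unfold beta
  have hπ : π ≠ 0 := Real.pi_ne_zero
  field_simp
  ring

/-- The tower weight is non-negative in the cone and at the partner charge
(`t' + π/3 = −(t + π/3) ∈ (−π/2, π/2)`). -/
theorem magicWeight_nonneg_of_mem_cone {t : ℝ} (ht : t ∈ Set.Ioo (-(π / 6)) (π / 6)) :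
    0 ≤ magicWeight t ∧ 0 ≤ magicWeight (-t - 2 * π / 3) := by
  rw [magicWeight_doubling]
  refine (and_self_iff).2 ?_
  unfold magicWeight
  refine mul_nonneg (by norm_num) (Real.cos_nonneg_of_mem_Icc ⟨?_, ?_⟩)
  · linarith [ht.1, Real.pi_pos]
  · linarith [ht.2, Real.pi_pos]

/-- In the cone the tower weight is at most `√3 < 2`: `w(t) ≤ 1` for `t ≥ 0` and `w(t) < √3` for
`t > −π/6`; recorded in the weak form `w(t) ≤ 2` used for integrability of `w(t)^N`. -/
theorem magicWeight_le_two (t : ℝ) : magicWeight t ≤ 2 := by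
  unfold magicWeight
  linarith [Real.cos_le_one (t + π / 3)]

/-- **The density from weight doubling**: dividing the single-radius identities at `t'` and `t` gives
`E N = (2πβ/(3√3) + o(1)) log(1/r)`, and `2πβ/(3√3) = 1/(2π√3) = ν`. -/
theorem density_from_doubling : 2 * π * beta / (3 * Real.sqrt 3) = nuSix := by
  unfold beta nuSix
  have hπ : π ≠ 0 := Real.pi_ne_zero
  have h3 : Real.sqrt 3 ≠ 0 := by positivity
  field_simp
  ring

/-- `√3 ν = 1/(2π)`: the calibrated UV drift coefficient. -/
theorem sqrt_three_mul_nuSix : Real.sqrt 3 * nuSix = 1 / (2 * π) := by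
  unfold nuSix
  have hπ : π ≠ 0 := Real.pi_ne_zero
  have h3 : Real.sqrt 3 ≠ 0 := by positivity
  field_simp

/-- **Calibration = SSW**: once the density is `ν`, the cone law reads `E[w(t)^N] = r^{βt² + t/2π + o(1)}`,
and `βt² + t/2π` is exactly the CLE₆ magic exponent `Δ₆(t)` of the barrier file
(`Literature.Barriers.CriticalPhenomena.NestingBlind.magicExponent_six`; `t = π/6`: one-arm `5/48`,
`t = −π/3`: `−1/12`). -/
theorem calibrated_exponent_eq_magicExponent_six (t : ℝ) :
    beta * t ^ 2 + t / (2 * π) = Literature.Barriers.CriticalPhenomena.NestingBlind.magicExponent 6 t := by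
  rw [Literature.Barriers.CriticalPhenomena.NestingBlind.magicExponent_six]
  unfold beta
  ring

/-! ### The composition: the six statements imply the crux, by name -/

/-- **Glue** (registered sub-goal; anchor of this module on the crux item): the six stub statements imply
`NestingRigidity` (pure logic + `Filter.tendsto_of_subseq_tendsto`). Given the crux's antecedents
`MagicFormulaZ2` (hZ) and `MagicFormulaT` (hT): STUBS 1–2 calibrate (`ConeTiltLaw zEns`,
`NestingDensity zEns`) from hZ; STUB 3 (+ hT) gives positive tilt agreement; STUB 4 turns it into
nesting-law agreement (a.e. radii, `Eventually.mono`); then `d_CN(bond_δ, site_δ) → 0` because every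
mesh sequence `δₖ → 0⁺` has, by STUB 5 applied to bond-`ℤ²` and then to site-`𝕋` along the extracted
subsequence, a sub-subsequence on which both families converge to regular laws, and STUB 6 concludes
along it. The conclusion is the route decl itself (`LoopLimitZ2EqT` unfolds to the `d_CN` statement for
`zEns`/`tEns` by `rfl`). -/
theorem nestingRigidity_of_statements : ConeScaling → WeightDoubling → RingTomography →
    PGFUniqueness → Precompactness → TreeRigidity → NestingRigidity := by
  intro h₁ h₂ h₃ h₄ h₅ h₆ hZ hT
  have hcone : ConeTiltLaw zEns := h₁ hZ
  have hdens : NestingDensity zEns := h₂ hZ hcone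
  have htilt : PositiveTiltAgreement := h₃ hZ hT hcone hdens
  have hlaw : NestingLawAgreement := fun n x ↦
    (htilt n x).mono fun p hp hr hR ↦ h₄ n x p.1 p.2 (hp hr hR)
  obtain ⟨hpZ, hpT⟩ := h₅
  change Tendsto (fun δ : ℝ ↦ LoopConfig.cnLawEDist zEns.P (zEns.X δ) tEns.P (tEns.X δ))
    (𝓝[>] 0) (𝓝 0)
  refine Filter.tendsto_of_subseq_tendsto fun δs hδs ↦ ?_
  obtain ⟨φ, hφ, X, hXreg, hXlim⟩ := hpZ δs hδs
  have hδs' : Tendsto (δs ∘ φ) atTop (𝓝[>] (0 : ℝ)) := hδs.comp hφ.tendsto_atTop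
  obtain ⟨ψ, hψ, X', hX'reg, hX'lim⟩ := hpT (δs ∘ φ) hδs'
  have hδs'' : Tendsto (δs ∘ φ ∘ ψ) atTop (𝓝[>] (0 : ℝ)) := hδs'.comp hψ.tendsto_atTop
  have hXlim' : Tendsto (fun k : ℕ ↦ LoopConfig.cnLawEDist zEns.P (zEns.X ((δs ∘ φ ∘ ψ) k))
      volume X) atTop (𝓝 0) := hXlim.comp hψ.tendsto_atTop
  exact ⟨φ ∘ ψ, h₆ (δs ∘ φ ∘ ψ) X X' hδs'' hXlim' hX'lim hXreg hX'reg hlaw⟩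

end Summit.CriticalPhenomena.CardyFormulaZ2.Cruxes.NestingRigidity.PositiveConeWeightDoubling

end
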